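import Mathlib
import HarnessLib
import Literature.Computability.AlgebraicComplexity.SupportRank
import Literature.Computability.AlgebraicComplexity.SupportRankProofs
import Literature.Computability.AlgebraicComplexity.SupportRankWeightRemoval
import Summits.MatrixMultiplication.MatrixMultiplication.Theses.CommutativeSchemes

/-!
# Crux `WeightRemoval` (stmt-MatrixMultiplication-9463) — `Lines/birth.lean`, the BC3 birth skeleton

**LINE CLOSED (lead prover-line-stmt-MatrixMultiplication-9463-0, 2026-08-17):** both stubs are closed
below by the tree discharges `CohnUmans2013_prop_5_holds` / `CohnUmans2013_thm_6_holds` (no `sorry`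
left), and the crux item is PROVED: `Theorems/CommutativeSchemesWeightRemoval.lean` (p146977, commit
f81eb451430e), closing theorem
`Summit.MatrixMultiplication.MatrixMultiplication.Theorems.weightRemoval_proof : …Theses.CommutativeSchemes.WeightRemoval`
(`closed_as: proved`).  The original registrar text follows.

Route `CommutativeSchemes` (route-MatrixMultiplication-CommutativeSchemes; deciding theorem
`closes : CommutativeRealization → RealizationSRank → WeightRemoval → MatrixMultiplication`, with
`RealizationSRank` proved, so `WeightRemoval` is — with the target `CommutativeRealization` — one of the
two open binders of `closes`; re-audit bin REPAIRABLE).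

The crux (rank 2, "CU13 Prop. 5 + Thm. 6 in finite form"):

  `WeightRemoval : ∀ ε > 0, ∀ n ≥ 2, (∃ t with supp t = supp ⟨n,n,n⟩ over ℂ and R(t) ≤ n^(2+ε)) →
     ω(ℂ) ≤ 2 + (3/2)·ε`.

THE LINE = the route header's own proof-in-print (CohnUmans2013 = arXiv:1207.6528, §3), cut at its
two published theorems, each stated over the tree's s-rank vocabulary
(`Literature/Computability/AlgebraicComplexity/SupportRank.lean`: `supportRank = R_s`,
`omegaS K = ω_s(K) = inf {τ : R_s(⟨n,n,n⟩) = O(n^τ)}`):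

* `stub_sRankExponent` — CU13 PROPOSITION 5, `(l·m·n)^(ω_s/3) ≤ R_s(⟨l,m,n⟩)` for all `l, m, n`
  (s-rank is submultiplicative under Kronecker products and `supp(⟨n,n,n⟩^{⊗k}) = supp ⟨n^k,n^k,n^k⟩`,
  so `R_s(⟨N^i,N^i,N^i⟩) ≤ R_s(⟨N,N,N⟩)^i` and `ω_s ≤ 3 log R_s(⟨l,m,n⟩) / log(lmn)` after
  symmetrisation). Signature = the named fact `CohnUmans2013_prop_5`, unfolded. Size M.
* `stub_weightRemovalExponent` — CU13 THEOREM 6, `ω ≤ (3ω_s − 2)/2` (a triangle-free `S ⊆ Δ_N`,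
  `|S| = N^(2−o(1))`, makes `|S| ⊙ ⟨N²,N²,N²⟩` a restriction of `T^{⊗3}` for any `T` with the support
  of `⟨N,N,N⟩`; then the asymptotic sum inequality). Signature = the named fact `CohnUmans2013_thm_6`,
  unfolded. Size L — the load-bearing stub.
* `WeightRemoval_of : <stub₁-sig> → <stub₂-sig> → WeightRemoval` — the sorry-free composition, which
  is exactly the finite-form bookkeeping the item's informal text describes: from the witness `t`,
  `R_s(⟨n,n,n⟩) ≤ R(t) ≤ n^(2+ε)`; Prop. 5 at `(n,n,n)` reads `(n³)^(ω_s/3) = n^(ω_s) ≤ R_s(⟨n,n,n⟩)`,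
  so `n^(ω_s) ≤ n^(2+ε)` and (`n ≥ 2 > 1`) `ω_s ≤ 2 + ε`; Thm. 6 then gives
  `ω ≤ (3(2+ε) − 2)/2 = 2 + (3/2)ε`.
* `weightRemoval_of_stubs : WeightRemoval` — the crux BY NAME from the two declared stubs (the file's
  only `sorry`s are inside `stub_*`; `closed = false` only through them).

HONEST STATUS (for the lead / the re-audit). Both stubs are ALREADY THEOREMS OF THE TREE (landed after
the route was filed on 2026-08-15): `stub_sRankExponent` is discharged verbatim by
`Literature.Computability.AlgebraicComplexity.CohnUmans2013_prop_5_holds`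
(`SupportRankProofs.lean`) and `stub_weightRemovalExponent` by
`Literature.Computability.AlgebraicComplexity.CohnUmans2013_thm_6_holds`
(`SupportRankWeightRemoval.lean`, 555 lines: the cube substitution
`tensorRank_multiple_matMulTensor_le_cube`, Behrend triangle-free families `exists_triangleFree`,
`two_add_two_mul_omega_le`). Hence the crux is PROVABLE NOW by a prover in two lines
(`WeightRemoval_of CohnUmans2013_prop_5_holds CohnUmans2013_thm_6_holds`, or the tree's own sanity
derivation `omega_le_of_sameSupport_rank_le`); this skeleton deliberately imports only the
definitions file `SupportRank.lean`, not the two proof files, and proves nothing beyond the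
assembly (registrar remit). Consequence for the route: once 9463 closes, the only open binder of
`closes` is the target `CommutativeRealization` (CU13 Conj. 21) itself.

Disproof used: none exists — `ledger crux ls stmt-MatrixMultiplication-9463`: no workfiles before this
one (no `Disproof.lean`, no `Negative/`); `ledger negatives --problem MatrixMultiplication` has no
statement about `supportRank`/`omegaS`/weight removal; the item is refuter-checked TRUE-in-print
(checked_at 2026-08-15T15:00:41Z).
-/

-- `Summit.<Summit>.<Problem>`: for the single-conjunct summit the duplicate component is mandated.
set_option linter.dupNamespace false

namespace Summit.MatrixMultiplication.MatrixMultiplication.Cruxes.WeightRemoval.Birth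

open Literature.Computability.AlgebraicComplexity
open Summit.MatrixMultiplication.MatrixMultiplication.Theses.CommutativeSchemes

/-! ## The two registered stubs -/

/-- **Stub 1 — Cohn–Umans 2013, Proposition 5 (the s-rank exponent is a per-format lower bound):**
for all `l m n`, `(l·m·n)^(ω_s(ℂ)/3) ≤ R_s(⟨l,m,n⟩)`. Why plausibly true: it is a published theorem
(s-rank is submultiplicative, `R_s(s ⊗ t) ≤ R_s(s) R_s(t)`, and Kronecker powers of `⟨l,m,n⟩` have the
support of `⟨lᵏ,mᵏ,nᵏ⟩`; symmetrise over the three rotations and take `k → ∞` in the definition of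
`ω_s`), and it is PROVED in the tree: `CohnUmans2013_prop_5_holds` (SupportRankProofs.lean) closes it
by `exact`. Size M. Role in the line: turns the finite witness `R_s(⟨n,n,n⟩) ≤ n^(2+ε)` into the
exponent bound `ω_s ≤ 2 + ε`. Sources: CohnUmans2013 = arXiv:1207.6528 §3 Prop. 5; Blaser2013 §5–7
(the tree's `tensorRank`/`omega` conventions). -/
theorem stub_sRankExponent :
    ∀ l m n : ℕ, ((l * m * n : ℕ) : ℝ) ^ (Literature.Computability.AlgebraicComplexity.omegaS ℂ / 3) ≤
      (Literature.Computability.AlgebraicComplexity.supportRank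
        (Literature.Computability.AlgebraicComplexity.matMulTensor ℂ l m n) : ℝ) :=
  CohnUmans2013_prop_5_holds

/-- **Stub 2 — Cohn–Umans 2013, Theorem 6 (weight removal): `ω(ℂ) ≤ (3 ω_s(ℂ) − 2) / 2`.**
Why plausibly true: it is a published theorem (for `T` with the support of `⟨N,N,N⟩` and a
triangle-free `S ⊆ Δ_N` of size `N^(2−o(1))` (Salem–Spencer/Behrend, CKSU05 §6.2), the direct sum
`|S| ⊙ ⟨N²,N²,N²⟩` is a restriction of `T ⊗ T ⊗ T` after rescaling variables by the inverse weights, so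
`|S| (N²)^ω ≤ R(T)³` by the asymptotic sum inequality, i.e. `2 + 2ω ≤ 3ω_s`), and it is PROVED in the
tree: `CohnUmans2013_thm_6_holds` (SupportRankWeightRemoval.lean) closes it by `exact`. Size L — the
load-bearing stub of the line. Sources: CohnUmans2013 = arXiv:1207.6528 §3 Thm. 6;
CohnKleinbergSzegedyUmans2005 §6.2; Blaser2013 Lemma 7.7. -/
theorem stub_weightRemovalExponent :
    Literature.Computability.AlgebraicComplexity.omega ℂ ≤
      (3 * Literature.Computability.AlgebraicComplexity.omegaS ℂ - 2) / 2 :=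
  CohnUmans2013_thm_6_holds

/-! ## Sorry-free composition: the two stubs prove the crux BY NAME -/

/-- **THE SKELETON THEOREM** (BC3 shape `stub₁-sig → stub₂-sig → crux`): CU13 Prop. 5 and Thm. 6
imply the route item `WeightRemoval` (stmt-MatrixMultiplication-9463). The finite-form bookkeeping:
`R_s(⟨n,n,n⟩) ≤ R(t) ≤ n^(2+ε)` for the witness `t` (same support); Prop. 5 at `(n,n,n)` is
`(n³)^(ω_s/3) = n^(ω_s) ≤ R_s(⟨n,n,n⟩)`; since `n ≥ 2 > 1`, `ω_s ≤ 2 + ε`; Thm. 6 gives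
`ω ≤ (3(2+ε) − 2)/2 = 2 + (3/2)ε`. Sorry-free, standard axioms. [cite: CohnUmans2013, Prop. 5, Thm. 6] -/
theorem WeightRemoval_of :
    (∀ l m n : ℕ, ((l * m * n : ℕ) : ℝ) ^ (Literature.Computability.AlgebraicComplexity.omegaS ℂ / 3) ≤
      (Literature.Computability.AlgebraicComplexity.supportRank
        (Literature.Computability.AlgebraicComplexity.matMulTensor ℂ l m n) : ℝ)) →
    (Literature.Computability.AlgebraicComplexity.omega ℂ ≤
      (3 * Literature.Computability.AlgebraicComplexity.omegaS ℂ - 2) / 2) →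
    Summit.MatrixMultiplication.MatrixMultiplication.Theses.CommutativeSchemes.WeightRemoval := by
  intro h5 h6 ε _hε n hn hex
  obtain ⟨t, ht, htr⟩ := hex
  have hn0 : (0 : ℝ) < n := by exact_mod_cast (by omega : 0 < n)
  have hn1 : (1 : ℝ) < n := by exact_mod_cast (by omega : 1 < n)
  -- the witness has the support of `⟨n,n,n⟩` (the item states the iff in the other direction)
  have hst : SameSupport (matMulTensor ℂ n n n) t := fun i j k => (ht i j k).symm
  -- `R_s(⟨n,n,n⟩) ≤ R(t) ≤ n^(2+ε)`
  have hs : (supportRank (matMulTensor ℂ n n n) : ℝ) ≤ (n : ℝ) ^ (2 + ε) := by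
    have h1 : supportRank (matMulTensor ℂ n n n) ≤ tensorRank t :=
      supportRank_le_of_sameSupport hst le_rfl
    exact le_trans (by exact_mod_cast h1) htr
  -- Prop. 5 at `(n,n,n)`: `(n³)^(ω_s/3) = n^(ω_s) ≤ R_s(⟨n,n,n⟩)`
  have hp := h5 n n n
  have hpow : ((n * n * n : ℕ) : ℝ) ^ (omegaS ℂ / 3) = (n : ℝ) ^ omegaS ℂ := by
    have h3 : ((n * n * n : ℕ) : ℝ) = (n : ℝ) ^ (3 : ℝ) := by
      push_cast
      rw [show (3 : ℝ) = ((3 : ℕ) : ℝ) by norm_num, Real.rpow_natCast]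
      ring
    rw [h3, ← Real.rpow_mul hn0.le]
    congr 1
    ring
  rw [hpow] at hp
  -- `n^(ω_s) ≤ n^(2+ε)` with `n > 1`, so `ω_s ≤ 2 + ε`
  have hle : (n : ℝ) ^ omegaS ℂ ≤ (n : ℝ) ^ (2 + ε) := hp.trans hs
  have hωs : omegaS ℂ ≤ 2 + ε := (Real.rpow_le_rpow_left_iff hn1).1 hle
  -- Thm. 6: `ω ≤ (3ω_s − 2)/2 ≤ (3(2+ε) − 2)/2 = 2 + (3/2)ε`
  calc omega ℂ ≤ (3 * omegaS ℂ - 2) / 2 := h6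
    _ ≤ (3 * (2 + ε) - 2) / 2 := by gcongr
    _ = 2 + 3 / 2 * ε := by ring

/-- The crux `Summit.MatrixMultiplication.MatrixMultiplication.Theses.CommutativeSchemes.WeightRemoval`
concluded BY NAME from the two DECLARED stubs `stub_sRankExponent`, `stub_weightRemovalExponent`
(the only `sorry`s of the file) through the sorry-free `WeightRemoval_of`. A prover closes the item by
replacing the two stubs with `CohnUmans2013_prop_5_holds` / `CohnUmans2013_thm_6_holds`. [folklore] -/
theorem weightRemoval_of_stubs :
    Summit.MatrixMultiplication.MatrixMultiplication.Theses.CommutativeSchemes.WeightRemoval :=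
  WeightRemoval_of stub_sRankExponent stub_weightRemovalExponent

end Summit.MatrixMultiplication.MatrixMultiplication.Cruxes.WeightRemoval.Birth
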